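import Summits.HodgeConjecture.HodgeConjecture.Theorems.HeckePrymWeilWeilTenfoldsSqrtMinus11NormAnchorWeilClasses
import Summits.HodgeConjecture.HodgeConjecture.Theorems.HeckePrymWeilWeilTenfoldsSqrtMinus11StubWeilPlaneTyping
import HarnessLib

/-!
# Crux `WeilTenfoldsSqrtMinus11` (stmt-HodgeConjecture-1262), line `quaternionic-norm-anchors` —
# the crux HOLDS ON EVERY NORM ANCHOR (granted Lefschetz `(1,1)`), in the route's literal typing

The anchor theorem `NormAnchor.weilClassesOf_le_algebraicClasses_of_normAnchor` (`…NormAnchorWeilClasses`)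
combined with the landed typing bridge `eigenspace_one_add_eq_weilClassesPlus/Minus` (stub T,
`…StubWeilPlaneTyping`): for a complex abelian tenfold `A` with `ψ¹¹ = 𝟙`, `Σ_{k<11} ψᵏ = 0`,
`φ = g(ψ)` the Gauss sum and the typed `L`-signature condition, EVERY class of the crux's Weil span
`Eig((𝟙+φ)^*, (1+i√11)¹⁰) ⊔ Eig((𝟙+φ)^*, (1-i√11)¹⁰) ⊆ H¹⁰(A(ℂ);ℂ)` is algebraic — in particular the
conclusion of `HeckePrymWeil.WeilTenfoldsSqrtMinus11` for `(A, φ)` (its rationality and Hodge-type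
hypotheses are not even needed). Lead `prover-line-stmt-HodgeConjecture-1262-c1-0`, 2026-08-16.
-/

noncomputable section

set_option linter.dupNamespace false

open CategoryTheory AlgebraicGeometry Complex
open Literature.AlgebraicGeometry.Motives Literature.AlgebraicGeometry.HodgeTheory
open Literature.AlgebraicTopology.SingularHomology

namespace Summit.HodgeConjecture.HodgeConjecture.Theorems.HeckePrymWeil

namespace NormAnchor

/-- **The anchor theorem, UNCONDITIONAL form (divisorial signature hypothesis).** Same as
`weilClassesOf_le_algebraicClasses_of_normAnchor` (part 2), but with the typed `L`-signature condition
stated directly on DIVISOR classes — every `(1+u)²`-eigenclass of `(𝟙+ψ)^*` on `H²` (`u¹¹ = 1`, `u ≠ 1`)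
lies in `algebraicClasses A.X 1 = N¹H²` — so that Lefschetz's theorem on `(1,1)`-classes is not needed:
on such a tenfold with `ψ¹¹ = 𝟙`, `Σ_{k<11} ψᵏ = 0`, `φ = g(ψ)`, the whole Weil plane
`weilClassesOf A φ 5 11` consists of algebraic classes. (Proof: §6 of part 2 verbatim, the pair products
being divisor classes by hypothesis.) [cite: vanGeemen1994HodgeAV, proof of Thm. 6.12]
[cite: MoonenZarhin1998WeilClasses, §2–§5] -/
theorem weilClassesOf_le_algebraicClasses_of_normAnchor_divisorial {A : AbelianVariety ℂ} {ψ φ : A ⟶ A}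
    (hA : A.dim = 10) (h11 : (CategoryTheory.End.of ψ) ^ 11 = 1)
    (hnorm : (Finset.range 11).sum (fun k => (CategoryTheory.End.of ψ) ^ k) = 0) (hφ : ((CategoryTheory.End.of φ) = (CategoryTheory.End.of ψ) + (CategoryTheory.End.of ψ) ^ 3 + (CategoryTheory.End.of ψ) ^ 4 + (CategoryTheory.End.of ψ) ^ 5 + (CategoryTheory.End.of ψ) ^ 9 - (CategoryTheory.End.of ψ) ^ 2 - (CategoryTheory.End.of ψ) ^ 6 - (CategoryTheory.End.of ψ) ^ 7 - (CategoryTheory.End.of ψ) ^ 8 - (CategoryTheory.End.of ψ) ^ 10))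
    (hsig : ∀ u : ℂ, u ^ 11 = 1 → u ≠ 1 →
      Module.End.eigenspace (complexBetti.map (𝟙 A + ψ).hom.hom.hom 2).hom ((1 + u) ^ 2) ≤
        algebraicClasses A.X 1) :
    weilClassesOf A φ 5 11 ≤ algebraicClasses A.X 5 := by
  classical
  haveI := finite_complexBetti_abelianVariety A 1
  -- data
  set s : ℂ := Complex.I * (Real.sqrt (11 : ℕ) : ℂ) with hs
  set S := Finset.univ.filter fun j : Fin 10 => (((Complex.exp (2 * (Real.pi : ℂ) * Complex.I / 11)) ^ ((j : ℕ) + 1)) + ((Complex.exp (2 * (Real.pi : ℂ) * Complex.I / 11)) ^ ((j : ℕ) + 1)) ^ 3 + ((Complex.exp (2 * (Real.pi : ℂ) * Complex.I / 11)) ^ ((j : ℕ) + 1)) ^ 4 + ((Complex.exp (2 * (Real.pi : ℂ) * Complex.I / 11)) ^ ((j : ℕ) + 1)) ^ 5 + ((Complex.exp (2 * (Real.pi : ℂ) * Complex.I / 11)) ^ ((j : ℕ) + 1)) ^ 9 - ((Complex.exp (2 * (Real.pi : ℂ) * Complex.I / 11)) ^ ((j : ℕ) + 1)) ^ 2 -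 ((Complex.exp (2 * (Real.pi : ℂ) * Complex.I / 11)) ^ ((j : ℕ) + 1)) ^ 6 - ((Complex.exp (2 * (Real.pi : ℂ) * Complex.I / 11)) ^ ((j : ℕ) + 1)) ^ 7 - ((Complex.exp (2 * (Real.pi : ℂ) * Complex.I / 11)) ^ ((j : ℕ) + 1)) ^ 8 - ((Complex.exp (2 * (Real.pi : ℂ) * Complex.I / 11)) ^ ((j : ℕ) + 1)) ^ 10) = s with hS
  have hS5 : S.card = 5 := card_plusIndices hA hφ h11 hnorm
  have hN := isInternal_U h11 hnorm
  have hΛ : HasExteriorCohomologyH1 ℂ (ComplexPoints A.X) :=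
    abelianVarietyCohomologyExteriorH1_holds.hasExteriorCohomologyH1 A
  have hb₁ : Module.finrank ℂ (complexBetti A.X 1) = 2 * (2 * 5) := by
    rw [abelianVarietyCohomologyExteriorH1_holds.finrank_one A, hA]
  have hφφ : φ ≫ φ = -(11 • 𝟙 A) := comp_self_of_isGaussSumOf hφ h11 hnorm
  -- divisor classes: `(1+u)²`-eigenclasses of `(𝟙+ψ)^*` are algebraic (divisorial signature hypothesis)
  have hdiv : ∀ j : Fin 10, ∀ b ∈ (Module.End.eigenspace (complexBetti.map ψ.hom.hom.hom 1).hom ((Complex.exp (2 * (Real.pi : ℂ) * Complex.I / 11)) ^ (((j : Fin 10) : ℕ) + 1))), ∀ b' ∈ (Module.End.eigenspace (complexBetti.map ψ.hom.hom.hom 1).hom ((Complex.exp (2 * (Real.pi : ℂ) * Complex.I / 11)) ^ (((j : Fin 10) : ℕ) + 1))),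
      cupProduct (show 1 + 1 = 2 from rfl) b b' ∈ algebraicClasses A.X 1 := by
    intro j b hb b' hb'
    have hu11 : ((Complex.exp (2 * (Real.pi : ℂ) * Complex.I / 11)) ^ ((j : ℕ) + 1)) ^ 11 = 1 := by
      rw [← pow_mul, mul_comm ((j : ℕ) + 1) 11, pow_mul, zeta_isPrimitiveRoot.pow_eq_one, one_pow]
    have hu1 : (Complex.exp (2 * (Real.pi : ℂ) * Complex.I / 11)) ^ ((j : ℕ) + 1) ≠ 1 := by
      intro h
      have := zeta_isPrimitiveRoot.pow_inj (i := (j : ℕ) + 1) (j := 0) (by omega) (by omega)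
        (by rw [h, pow_zero])
      omega
    exact hsig _ hu11 hu1 (cupProduct_mem_eigenspace_one_add hb hb')
  -- an eigenbasis of `H¹` adapted to `H¹ = ⊕_j U_j`, the five `+`-planes first
  let bU : ∀ j : Fin 10, Module.Basis (Fin 2) ℂ ((Module.End.eigenspace (complexBetti.map ψ.hom.hom.hom 1).hom ((Complex.exp (2 * (Real.pi : ℂ) * Complex.I / 11)) ^ (((j : Fin 10) : ℕ) + 1)))) := fun j =>
    Module.finBasisOfFinrankEq ℂ _ (finrank_U hA h11 hnorm j)
  let B : Module.Basis (Σ _j : Fin 10, Fin 2) ℂ (complexBetti A.X 1) := hN.collectedBasis bU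
  obtain ⟨τ, hτS, hτpair⟩ := exists_pairIndexEquiv S hS5
  let B' : Module.Basis (Fin (10 + 10)) ℂ (complexBetti A.X 1) := B.reindex τ.symm
  have hB' : ∀ i, B' i = B (τ i) := fun i => by
    change (B.reindex τ.symm) i = _
    rw [Module.Basis.reindex_apply, Equiv.symm_symm]
  have hmemU : ∀ k : Fin 10, B' (Fin.castAdd 10 k) ∈ (Module.End.eigenspace (complexBetti.map ψ.hom.hom.hom 1).hom ((Complex.exp (2 * (Real.pi : ℂ) * Complex.I / 11)) ^ ((((τ (Fin.castAdd 10 k)).1 : Fin 10) : ℕ) + 1))) := by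
    intro k
    rw [hB']
    exact hN.collectedBasis_mem bU _
  have hmemV : ∀ k : Fin 10, B' (Fin.castAdd 10 k) ∈ Module.End.eigenspace (complexBetti.map φ.hom.hom.hom 1).hom s := by
    intro k
    have hj := hτS k
    rw [hS, Finset.mem_filter] at hj
    rw [← hj.2]
    exact eigenspace_le_eigenspace_gval hφ _ (hmemU k)
  -- the wedge of the ten `+`-vectors
  let Bw : Module.Basis (Set.powersetCard (Fin (10 + 10)) 10) ℂ (complexBetti A.X 10) :=
    (B'.exteriorPower 10).map (hΛ.equiv 10)
  let S₀ : Set.powersetCard (Fin (10 + 10)) 10 := Set.powersetCard.ofFinEmbEquiv (Fin.castAddOrderEmb 10)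
  set w : complexBetti A.X (2 * 5) := Bw S₀ with hwdef
  have hw : w = cupPowOne ℂ (ComplexPoints A.X) 10 (fun k => B' (Fin.castAdd 10 k)) := by
    rw [hwdef]
    change hΛ.equiv 10 ((B'.exteriorPower 10) S₀) = _
    rw [exteriorPower.basis_apply, HasExteriorCohomologyH1.equiv_apply, exteriorPower.ιMulti_family,
      wedgeToCup_ιMulti]
    congr 1
    funext k
    simp only [Function.comp_apply, S₀, Equiv.symm_apply_apply]
    rfl
  have hw0 : w ≠ 0 := Bw.ne_zero S₀
  -- `w ∈ E₊`
  have hwW : w ∈ weilClassesPlus A φ 5 11 := by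
    rw [mem_weilClassesPlus_iff]
    intro x y
    rw [hw]
    change singularCohomology.map ℂ ℂ _ 10 (cupPowOne ℂ _ 10 _) = _
    rw [map_cupPowOne]
    have e : (fun i => singularCohomology.map ℂ ℂ
        (AlgPoints.mapContinuous (L := ℂ) (x • 𝟙 A + y • φ).hom.hom.hom) 1 (B' (Fin.castAdd 10 i))) =
        fun i => ((x : ℂ) + (y : ℂ) * s) • B' (Fin.castAdd 10 i) :=
      funext fun i => complexBetti_map_nsmul_id_add_nsmul_one_of_mem_eigenspace (hmemV i) x y
    rw [e, MultilinearMap.map_smul_univ, Finset.prod_const, Finset.card_univ, Fintype.card_fin, hs,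
      ← mul_assoc]
  -- `w` is algebraic
  have hwalg : w ∈ algebraicClasses A.X 5 := by
    rw [hw]
    refine cupPowOne_mem_algebraicClasses_of_pairs 5 (fun k => B' (Fin.castAdd 10 k)) ?_
    intro a
    have hm0 := hmemU ⟨2 * (a : ℕ), by omega⟩
    have hm1 := hmemU ⟨2 * (a : ℕ) + 1, by omega⟩
    rw [← hτpair a] at hm1
    exact hdiv _ _ hm0 _ hm1
  -- conclusion: both Weil lines are spanned by algebraic classes
  have hplus : weilClassesPlus A φ 5 11 ≤ algebraicClasses A.X 5 :=
    (weilClassesPlus_le_span_singleton hΛ hb₁ (by norm_num) hφφ hwW hw0).trans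
      ((Submodule.span_singleton_le_iff_mem _ _).mpr hwalg)
  obtain ⟨w', hw'W, hw'alg, hw'0⟩ :=
    exists_mem_weilClassesMinus_mem_algebraicClasses ⟨w, hwW, hwalg, hw0⟩
  have hminus : weilClassesMinus A φ 5 11 ≤ algebraicClasses A.X 5 :=
    (weilClassesMinus_le_span_singleton hΛ hb₁ (by norm_num) hφφ hw'W hw'0).trans
      ((Submodule.span_singleton_le_iff_mem _ _).mpr hw'alg)
  exact sup_le hplus hminus

/-- **`WeilTenfoldsSqrtMinus11` holds on every norm anchor with divisorial signature — unconditionally.**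
The route's literal Weil span `Eig((𝟙+φ)^*, (1+i√11)¹⁰) ⊔ Eig((𝟙+φ)^*, (1-i√11)¹⁰)` of `(A, φ)` lies in
`algebraicClasses A.X 5` (divisorial anchor theorem + the landed typing bridge
`eigenspace_one_add_eq_weilClassesPlus/Minus`). [cite: vanGeemen1994HodgeAV, proof of Thm. 6.12] -/
theorem weilTenfolds_conclusion_of_normAnchor_divisorial {A : AbelianVariety ℂ} {ψ φ : A ⟶ A}
    (hA : A.dim = 10) (h11 : (CategoryTheory.End.of ψ) ^ 11 = 1)
    (hnorm : (Finset.range 11).sum (fun k => (CategoryTheory.End.of ψ) ^ k) = 0)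
    (hφ : (CategoryTheory.End.of φ) = (CategoryTheory.End.of ψ) + (CategoryTheory.End.of ψ) ^ 3 +
      (CategoryTheory.End.of ψ) ^ 4 + (CategoryTheory.End.of ψ) ^ 5 + (CategoryTheory.End.of ψ) ^ 9 -
      (CategoryTheory.End.of ψ) ^ 2 - (CategoryTheory.End.of ψ) ^ 6 - (CategoryTheory.End.of ψ) ^ 7 -
      (CategoryTheory.End.of ψ) ^ 8 - (CategoryTheory.End.of ψ) ^ 10)
    (hsig : ∀ u : ℂ, u ^ 11 = 1 → u ≠ 1 →
      Module.End.eigenspace (complexBetti.map (𝟙 A + ψ).hom.hom.hom 2).hom ((1 + u) ^ 2) ≤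
        algebraicClasses A.X 1) :
    ∀ c : complexBetti A.X 10,
      c ∈ Module.End.eigenspace (complexBetti.map (𝟙 A + φ).hom.hom.hom 10).hom
            ((1 + Complex.I * (Real.sqrt (11 : ℝ) : ℂ)) ^ 10) ⊔
          Module.End.eigenspace (complexBetti.map (𝟙 A + φ).hom.hom.hom 10).hom
            ((1 - Complex.I * (Real.sqrt (11 : ℝ) : ℂ)) ^ 10) →
      c ∈ algebraicClasses A.X 5 := by
  intro c hc
  have hφφ : φ ≫ φ = -(11 • 𝟙 A) := comp_self_of_isGaussSumOf hφ h11 hnorm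
  have hW : c ∈ weilClassesOf A φ 5 11 := by
    have hP := eigenspace_one_add_eq_weilClassesPlus A hφφ
    have hM := eigenspace_one_add_eq_weilClassesMinus A hφφ
    change c ∈ Module.End.eigenspace (complexBetti.map (𝟙 A + φ).hom.hom.hom (2 * 5)).hom
        ((1 + Complex.I * (Real.sqrt (11 : ℝ) : ℂ)) ^ 10) ⊔
      Module.End.eigenspace (complexBetti.map (𝟙 A + φ).hom.hom.hom (2 * 5)).hom
        ((1 - Complex.I * (Real.sqrt (11 : ℝ) : ℂ)) ^ 10) at hc
    rw [hP, hM] at hc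
    exact hc
  exact weilClassesOf_le_algebraicClasses_of_normAnchor_divisorial hA h11 hnorm hφ hsig hW

/-- **`WeilTenfoldsSqrtMinus11` holds on every norm anchor, granted `lefschetzOneOne_rational`.**
For a complex abelian tenfold `A`, `ψ : A ⟶ A` with `ψ¹¹ = 𝟙` and `Σ_{k<11} ψᵏ = 0` in `End A`,
`φ = Σ_{k=1}^{10} (k|11) ψᵏ`, and the typed signature condition (every `(1+u)²`-eigenclass of `(𝟙+ψ)^*`
on `H²`, `u¹¹ = 1`, `u ≠ 1`, is a `ℂ`-combination of rational `(1,1)`-classes): every class of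
`Eig((𝟙+φ)^*, (1+i√11)¹⁰) ⊔ Eig((𝟙+φ)^*, (1-i√11)¹⁰)` lies in `algebraicClasses A.X 5`
(anchor theorem + typing bridge; `φ ≫ φ = -11` by `comp_self_of_isGaussSumOf`).
[cite: vanGeemen1994HodgeAV, proof of Thm. 6.12] [cite: MoonenZarhin1998WeilClasses, §2–§5] -/
theorem weilTenfolds_conclusion_of_normAnchor (hL : lefschetzOneOne_rational) {A : AbelianVariety ℂ}
    {ψ φ : A ⟶ A} (hA : A.dim = 10) (h11 : (CategoryTheory.End.of ψ) ^ 11 = 1)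
    (hnorm : (Finset.range 11).sum (fun k => (CategoryTheory.End.of ψ) ^ k) = 0)
    (hφ : (CategoryTheory.End.of φ) = (CategoryTheory.End.of ψ) + (CategoryTheory.End.of ψ) ^ 3 +
      (CategoryTheory.End.of ψ) ^ 4 + (CategoryTheory.End.of ψ) ^ 5 + (CategoryTheory.End.of ψ) ^ 9 -
      (CategoryTheory.End.of ψ) ^ 2 - (CategoryTheory.End.of ψ) ^ 6 - (CategoryTheory.End.of ψ) ^ 7 -
      (CategoryTheory.End.of ψ) ^ 8 - (CategoryTheory.End.of ψ) ^ 10)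
    (hsig : ∀ u : ℂ, u ^ 11 = 1 → u ≠ 1 →
      Module.End.eigenspace (complexBetti.map (𝟙 A + ψ).hom.hom.hom 2).hom ((1 + u) ^ 2) ≤
        Submodule.span ℂ {b : complexBetti A.X 2 | IsRationalClass b ∧ IsOfHodgeType 10 A.X 2 1 1 b}) :
    ∀ c : complexBetti A.X 10, IsRationalClass c → IsOfHodgeType 10 A.X 10 5 5 c →
      c ∈ Module.End.eigenspace (complexBetti.map (𝟙 A + φ).hom.hom.hom 10).hom
            ((1 + Complex.I * (Real.sqrt (11 : ℝ) : ℂ)) ^ 10) ⊔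
          Module.End.eigenspace (complexBetti.map (𝟙 A + φ).hom.hom.hom 10).hom
            ((1 - Complex.I * (Real.sqrt (11 : ℝ) : ℂ)) ^ 10) →
      c ∈ algebraicClasses A.X 5 := by
  intro c _ _ hc
  have hφφ : φ ≫ φ = -(11 • 𝟙 A) := comp_self_of_isGaussSumOf hφ h11 hnorm
  have hW : c ∈ weilClassesOf A φ 5 11 := by
    have hP := eigenspace_one_add_eq_weilClassesPlus A hφφ
    have hM := eigenspace_one_add_eq_weilClassesMinus A hφφ
    change c ∈ Module.End.eigenspace (complexBetti.map (𝟙 A + φ).hom.hom.hom (2 * 5)).hom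
        ((1 + Complex.I * (Real.sqrt (11 : ℝ) : ℂ)) ^ 10) ⊔
      Module.End.eigenspace (complexBetti.map (𝟙 A + φ).hom.hom.hom (2 * 5)).hom
        ((1 - Complex.I * (Real.sqrt (11 : ℝ) : ℂ)) ^ 10) at hc
    rw [hP, hM] at hc
    exact hc
  exact weilClassesOf_le_algebraicClasses_of_normAnchor hL hA h11 hnorm hφ hsig hW

end NormAnchor

/-- **Registered sub-goal `stub_normAnchorCrux` of crux stmt-HodgeConjecture-1262 (line
`quaternionic-norm-anchors`)**: granted `lefschetzOneOne_rational`, the crux `WeilTenfoldsSqrtMinus11` in its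
literal typing holds on every norm anchor (`NormAnchor.weilTenfolds_conclusion_of_normAnchor`).
[cite: vanGeemen1994HodgeAV, proof of Thm. 6.12] [cite: MoonenZarhin1998WeilClasses, §2–§5] -/
theorem stub_normAnchorCrux : lefschetzOneOne_rational → ∀ (A : AbelianVariety ℂ) (ψ φ : A ⟶ A), A.dim = 10 → (CategoryTheory.End.of ψ) ^ 11 = 1 → (Finset.range 11).sum (fun k => (CategoryTheory.End.of ψ) ^ k) = 0 → (CategoryTheory.End.of φ) = (CategoryTheory.End.of ψ) + (CategoryTheory.End.of ψ) ^ 3 + (CategoryTheory.End.of ψ) ^ 4 + (CategoryTheory.End.of ψ) ^ 5 + (CategoryTheory.End.of ψ) ^ 9 - (CategoryTheory.End.of ψ) ^ 2 - (CategoryTheory.End.of ψ) ^ 6 - (CategoryTheory.End.of ψ) ^ 7 - (CategoryTheory.End.of ψ) ^ 8 - (CategoryTheory.End.of ψ) ^ 10 → (∀ u : ℂ, u ^ 11 = 1 → u ≠ 1 → Module.End.eigenspace (complexBetti.map (𝟙 A + ψ).hom.hom.hom 2).hom ((1 + u) ^ 2) ≤ Submodule.span ℂ {b : complexBetti A.X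 2 | IsRationalClass b ∧ IsOfHodgeType 10 A.X 2 1 1 b}) → ∀ c : complexBetti A.X 10, IsRationalClass c → IsOfHodgeType 10 A.X 10 5 5 c → c ∈ Module.End.eigenspace (complexBetti.map (𝟙 A + φ).hom.hom.hom 10).hom ((1 + Complex.I * (Real.sqrt (11 : ℝ) : ℂ)) ^ 10) ⊔ Module.End.eigenspace (complexBetti.map (𝟙 A + φ).hom.hom.hom 10).hom ((1 - Complex.I * (Real.sqrt (11 : ℝ) : ℂ)) ^ 10) → c ∈ algebraicClasses A.X 5 :=
  fun hL _ _ _ hA h11 hnorm hφ hsig =>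
    NormAnchor.weilTenfolds_conclusion_of_normAnchor hL hA h11 hnorm hφ hsig

end Summit.HodgeConjecture.HodgeConjecture.Theorems.HeckePrymWeil

end
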